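import Summits.QuantumFields.YangMills.Theorems.BalabanUVNodesN17AtRecord12
import Literature.MathematicalPhysics.QuantumFieldTheory.Balaban1983to89.Node00.Record12CarriersB13
import Literature.MathematicalPhysics.QuantumFieldTheory.Balaban1983to89.Node00.Record12CarriersB12PackageRecords

/-!
# BalabanUVNodes ∕ node N17 = NE4 AT NODE 00's STAGE-12 CARRIER-PINNED RECORDS (node00-def g32∕g33 `Node00/Record12CarriersRecords` p466349 ∕ `Record12CarriersB12`
# p466798, def-B13 `Record12CarriersB13` p466945, def-B12 `Record12CarriersB12PackageRecords`): companion 9 §32's `…₁₁CB10YZW(B8)` faces re-keyed `11 ↦ 12`, BY NAME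

Cell `pub-ymgap`, HUMAN RULING D-0062, seat `pub-ymgap-dag-n17-c` (R134 fan-out, strategy s2 = BY-NAME KNIT AT THE RECORD), generation 4; companion 18 of
`BalabanUVNodesN17Knit` … `…N17AtRecord12` (p462063, companion 13).  THEOREMS ONLY (0 `def`); imports companion 13 (N17 at `datumOfRecord₁₂` ∕ `IsRecordOfRecord₁₂C`:
`N17_of_isRecordOfRecord₁₂C`, `N17_iff_forall_of_isRecordOfRecord₁₂C`) and node00-def's ∕ def-B12's ∕ def-B13's Stage-12 carrier records with their maps to def-T's
`IsRecordOfRecord₁₂C` (`isRecordOfRecord₁₂C_of_isRecordOfRecord₁₂CB10YZW` — same datum, same world; `companion_of_isRecordOfRecord₁₂CB10YZWB8`,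
`exists_isRecordOfRecord₁₂C_of_isRecordOfRecord₁₂CB10YZWB8B12 ∕ …B8subB12 ∕ …B8B12B13 ∕ …B8subB12B13 ∕ …B8B12Prov ∕ …B8subB12Prov` — same datum, a companion world
with the SAME window `w'.γ = w.γ`); modifies nothing; every cited lemma used BY NAME.

THE POINT.  N17 reads a record `(D, w)` only through `D.βfun` and the window `w.γ` (`NE4OnData D cN ρ w.γ`), never through the world's upstream block `w.up` — which
is all the carrier pins change.  So companion 13's θ-keyed ∀-form hypothesis (the `βmT(θ)` rate at every admissible Stage-12 presentation `(θ, hP)` of `D` whose box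
contains the window) gives N17, and is EQUIVALENT to N17, at every pinned record exactly as at `₁₂C`:
* §46 hub: `N17_of_exists_companion₁₂C` ∕ `N17_iff_forall_of_exists_companion₁₂C` — at `(D, w)` it suffices that SOME world `w'` with `w'.γ = w.γ` makes `(D, w')` a
  ₁₂C record;
* §47 the eight pinned records: `N17_of_isRecordOfRecord₁₂CB10YZW` ∕ `…B8` ∕ `…B8B12` ∕ `…B8subB12` ∕ `…B8B12B13` ∕ `…B8subB12B13` ∕ `…B8B12Prov` ∕ `…B8subB12Prov`
  and the eight `N17_iff_forall_of_…`.
Consumers: the (B)-side knits at the pinned records (K1′ `StabilityBAtRecordR12e` faces of N05–N13) that want the N17 conjunct of a cluster statement at THEIR record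
predicate read it here by name; nothing else is claimed.

HONEST FRAMING.  Kernel bookkeeping BY NAME; 0 sorry; NE4 NOT IN PRINT ([Balaban1987RG1] (1.20)–(1.22) p. 264) and NOT PROVED; the ∀-form is a displayed
HYPOTHESIS; no pinned record is claimed inhabited (that is K0′ `Record12Inhabited` — the pins add and remove nothing: node00-def's `exists_world_…` take
`Provisos₁₂ ∧ Admissible` as hypotheses); nothing of Bałaban's asserted; N17 = composite (max of N15, N16, (D4)), NOT discharged; «A: n∕28» unmoved.  One finite
four-torus at fixed ε per run — NOT infinite volume, NOT OS on ℝ⁴, NOT a mass gap, NOT Clay.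
-/

noncomputable section

open scoped Matrix.Norms.L2Operator

namespace Summit.QuantumFields.YangMills.Theorems.BalabanUVNodesN17

open Literature.MathematicalPhysics.QuantumFieldTheory.Balaban1983to89
open Literature.MathematicalPhysics.QuantumFieldTheory.Balaban1983to89.FlowStep
open Literature.MathematicalPhysics.QuantumFieldTheory.Balaban1983to89.T4CouplingMatching
open Literature.MathematicalPhysics.QuantumFieldTheory.Balaban1983to89.T4Continuum (T4Family FiniteEpsData ULoop)
open Literature.MathematicalPhysics.QuantumFieldTheory.Balaban1983to89.Node00
open Literature.MathematicalPhysics.QuantumFieldTheory.Balaban1983to89.DagBinding (WorldP)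
open Summit.QuantumFields.BalabanUV.T4Continuum.Spine.NE4 (NE4OnData ne4OnData_iff)
open YMDAG.UVSplit (Datum)

variable {F : T4Family} {N : ℕ} [NeZero N]

/-! ## §46 HUB: A ₁₂C COMPANION WITH THE SAME DATUM AND THE SAME WINDOW CARRIES COMPANION 13's FACES -/

/-- **N17 AT `(D, w)` FROM A ₁₂C RECORD `(D, w')` WITH THE SAME WINDOW** (`w'.γ = w.γ`): companion 13's `N17_of_isRecordOfRecord₁₂C` at `w'`, transported along
`w'.γ = w.γ` — N17 reads `(D, w.γ)` only. [cite: Balaban1987RG1, (1.20)-(1.22) p.264; Balaban1989LargeFieldII, Thm 1 p.355] -/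
theorem N17_of_exists_companion₁₂C {D : Datum F N} {w : WorldP} (h : ∃ w' : WorldP, IsRecordOfRecord₁₂C F N D w' ∧ w'.γ = w.γ) {cN ρ : ℝ}
    (hin : ∀ (θ : Stage12Params F N) (hP : θ.Provisos₁₂ F N), θ.Admissible F N → D = datumOfRecord₁₂ F N θ hP → w.γ ≤ θ.γ →
      letI := θ.instVβ₁; letI := θ.instVβ₂; letI := θ.instιβ
      ScaleShiftRate cN ρ w.γ (betaMerged F (mergedTermFamilyMatT F N (TcOfRecord F N) (chiFixed7 F N θ.ν) θ.εbg) θ.ρ8 θ.bV)) :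
    NE4OnData D cN ρ w.γ := by
  obtain ⟨w', hw', hγ⟩ := h
  rw [← hγ] at hin ⊢
  exact N17_of_isRecordOfRecord₁₂C hw' hin

/-- **… AND THE θ-KEYED BINDER IS EQUIVALENT TO N17 THERE** (companion 13's `N17_iff_forall_of_isRecordOfRecord₁₂C` at the companion world).
[cite: Balaban1987RG1, (1.20)-(1.22) p.264; Balaban1989LargeFieldII, Thm 1 p.355] -/
theorem N17_iff_forall_of_exists_companion₁₂C {D : Datum F N} {w : WorldP} (h : ∃ w' : WorldP, IsRecordOfRecord₁₂C F N D w' ∧ w'.γ = w.γ) (cN ρ : ℝ) :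
    NE4OnData D cN ρ w.γ ↔
      ∀ (θ : Stage12Params F N) (hP : θ.Provisos₁₂ F N), θ.Admissible F N → D = datumOfRecord₁₂ F N θ hP → w.γ ≤ θ.γ →
        letI := θ.instVβ₁; letI := θ.instVβ₂; letI := θ.instιβ
        ScaleShiftRate cN ρ w.γ (betaMerged F (mergedTermFamilyMatT F N (TcOfRecord F N) (chiFixed7 F N θ.ν) θ.εbg) θ.ρ8 θ.bV) := by
  obtain ⟨w', hw', hγ⟩ := h
  rw [← hγ]
  exact N17_iff_forall_of_isRecordOfRecord₁₂C hw' cN ρ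

/-! ## §47 N17 AT THE EIGHT STAGE-12 CARRIER-PINNED RECORDS -/

/-- **N17 AT node00-def's FOUR-PIN STAGE-12 RECORD `IsRecordOfRecord₁₂CB10YZW`** — same datum, same world (`isRecordOfRecord₁₂C_of_isRecordOfRecord₁₂CB10YZW`).
[cite: Balaban1987RG1, (1.20)-(1.22) p.264; Balaban1989LargeFieldII, Thm 1 p.355] -/
theorem N17_of_isRecordOfRecord₁₂CB10YZW {D : Datum F N} {w : WorldP} (h : IsRecordOfRecord₁₂CB10YZW F N D w) {cN ρ : ℝ}
    (hin : ∀ (θ : Stage12Params F N) (hP : θ.Provisos₁₂ F N), θ.Admissible F N → D = datumOfRecord₁₂ F N θ hP → w.γ ≤ θ.γ →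
      letI := θ.instVβ₁; letI := θ.instVβ₂; letI := θ.instιβ
      ScaleShiftRate cN ρ w.γ (betaMerged F (mergedTermFamilyMatT F N (TcOfRecord F N) (chiFixed7 F N θ.ν) θ.εbg) θ.ρ8 θ.bV)) :
    NE4OnData D cN ρ w.γ :=
  N17_of_isRecordOfRecord₁₂C (isRecordOfRecord₁₂C_of_isRecordOfRecord₁₂CB10YZW h) hin

/-- The binder is equivalent to N17 at `IsRecordOfRecord₁₂CB10YZW`. [cite: Balaban1987RG1, (1.20)-(1.22) p.264; Balaban1989LargeFieldII, Thm 1 p.355] -/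
theorem N17_iff_forall_of_isRecordOfRecord₁₂CB10YZW {D : Datum F N} {w : WorldP} (h : IsRecordOfRecord₁₂CB10YZW F N D w) (cN ρ : ℝ) :
    NE4OnData D cN ρ w.γ ↔
      ∀ (θ : Stage12Params F N) (hP : θ.Provisos₁₂ F N), θ.Admissible F N → D = datumOfRecord₁₂ F N θ hP → w.γ ≤ θ.γ →
        letI := θ.instVβ₁; letI := θ.instVβ₂; letI := θ.instιβ
        ScaleShiftRate cN ρ w.γ (betaMerged F (mergedTermFamilyMatT F N (TcOfRecord F N) (chiFixed7 F N θ.ν) θ.εbg) θ.ρ8 θ.bV) :=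
  N17_iff_forall_of_isRecordOfRecord₁₂C (isRecordOfRecord₁₂C_of_isRecordOfRecord₁₂CB10YZW h) cN ρ

/-- **N17 AT THE FIVE-PIN RECORD `IsRecordOfRecord₁₂CB10YZWB8`** ([B8] surviving) — through node00-def's same-datum companion in `…CB10YZW` (same window).
[cite: Balaban1987RG1, (1.20)-(1.22) p.264; Balaban1989LargeFieldII, Thm 1 p.355] -/
theorem N17_of_isRecordOfRecord₁₂CB10YZWB8 {D : Datum F N} {w : WorldP} (h : IsRecordOfRecord₁₂CB10YZWB8 F N D w) {cN ρ : ℝ}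
    (hin : ∀ (θ : Stage12Params F N) (hP : θ.Provisos₁₂ F N), θ.Admissible F N → D = datumOfRecord₁₂ F N θ hP → w.γ ≤ θ.γ →
      letI := θ.instVβ₁; letI := θ.instVβ₂; letI := θ.instιβ
      ScaleShiftRate cN ρ w.γ (betaMerged F (mergedTermFamilyMatT F N (TcOfRecord F N) (chiFixed7 F N θ.ν) θ.εbg) θ.ρ8 θ.bV)) :
    NE4OnData D cN ρ w.γ := by
  obtain ⟨w', hw', -, hγ, -⟩ := companion_of_isRecordOfRecord₁₂CB10YZWB8 h
  exact N17_of_exists_companion₁₂C ⟨w', isRecordOfRecord₁₂C_of_isRecordOfRecord₁₂CB10YZW hw', hγ⟩ hin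

/-- The binder is equivalent to N17 at `IsRecordOfRecord₁₂CB10YZWB8`. [cite: Balaban1987RG1, (1.20)-(1.22) p.264; Balaban1989LargeFieldII, Thm 1 p.355] -/
theorem N17_iff_forall_of_isRecordOfRecord₁₂CB10YZWB8 {D : Datum F N} {w : WorldP} (h : IsRecordOfRecord₁₂CB10YZWB8 F N D w) (cN ρ : ℝ) :
    NE4OnData D cN ρ w.γ ↔
      ∀ (θ : Stage12Params F N) (hP : θ.Provisos₁₂ F N), θ.Admissible F N → D = datumOfRecord₁₂ F N θ hP → w.γ ≤ θ.γ →
        letI := θ.instVβ₁; letI := θ.instVβ₂; letI := θ.instιβ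
        ScaleShiftRate cN ρ w.γ (betaMerged F (mergedTermFamilyMatT F N (TcOfRecord F N) (chiFixed7 F N θ.ν) θ.εbg) θ.ρ8 θ.bV) := by
  obtain ⟨w', hw', -, hγ, -⟩ := companion_of_isRecordOfRecord₁₂CB10YZWB8 h
  exact N17_iff_forall_of_exists_companion₁₂C ⟨w', isRecordOfRecord₁₂C_of_isRecordOfRecord₁₂CB10YZW hw', hγ⟩ cN ρ

/-- **N17 AT THE SIX-PIN RECORD `IsRecordOfRecord₁₂CB10YZWB8B12`** ([B12] pinned) — through node00-def's `exists_isRecordOfRecord₁₂C_of_…B8B12` (same datum, same window).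
[cite: Balaban1987RG1, (1.20)-(1.22) p.264; Balaban1989LargeFieldII, Thm 1 p.355] -/
theorem N17_of_isRecordOfRecord₁₂CB10YZWB8B12 {D : Datum F N} {w : WorldP} (h : IsRecordOfRecord₁₂CB10YZWB8B12 F N D w) {cN ρ : ℝ}
    (hin : ∀ (θ : Stage12Params F N) (hP : θ.Provisos₁₂ F N), θ.Admissible F N → D = datumOfRecord₁₂ F N θ hP → w.γ ≤ θ.γ →
      letI := θ.instVβ₁; letI := θ.instVβ₂; letI := θ.instιβ
      ScaleShiftRate cN ρ w.γ (betaMerged F (mergedTermFamilyMatT F N (TcOfRecord F N) (chiFixed7 F N θ.ν) θ.εbg) θ.ρ8 θ.bV)) :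
    NE4OnData D cN ρ w.γ := by
  obtain ⟨w', hw', -, hγ, -⟩ := exists_isRecordOfRecord₁₂C_of_isRecordOfRecord₁₂CB10YZWB8B12 h
  exact N17_of_exists_companion₁₂C ⟨w', hw', hγ⟩ hin

/-- The binder is equivalent to N17 at `IsRecordOfRecord₁₂CB10YZWB8B12`. [cite: Balaban1987RG1, (1.20)-(1.22) p.264; Balaban1989LargeFieldII, Thm 1 p.355] -/
theorem N17_iff_forall_of_isRecordOfRecord₁₂CB10YZWB8B12 {D : Datum F N} {w : WorldP} (h : IsRecordOfRecord₁₂CB10YZWB8B12 F N D w) (cN ρ : ℝ) :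
    NE4OnData D cN ρ w.γ ↔
      ∀ (θ : Stage12Params F N) (hP : θ.Provisos₁₂ F N), θ.Admissible F N → D = datumOfRecord₁₂ F N θ hP → w.γ ≤ θ.γ →
        letI := θ.instVβ₁; letI := θ.instVβ₂; letI := θ.instιβ
        ScaleShiftRate cN ρ w.γ (betaMerged F (mergedTermFamilyMatT F N (TcOfRecord F N) (chiFixed7 F N θ.ν) θ.εbg) θ.ρ8 θ.bV) := by
  obtain ⟨w', hw', -, hγ, -⟩ := exists_isRecordOfRecord₁₂C_of_isRecordOfRecord₁₂CB10YZWB8B12 h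
  exact N17_iff_forall_of_exists_companion₁₂C ⟨w', hw', hγ⟩ cN ρ

/-- **N17 AT THE SIX-PIN RECORD `IsRecordOfRecord₁₂CB10YZWB8subB12`** ([B8′] view, [B12] pinned). [cite: Balaban1987RG1, (1.20)-(1.22) p.264; Balaban1989LargeFieldII, Thm 1 p.355] -/
theorem N17_of_isRecordOfRecord₁₂CB10YZWB8subB12 {D : Datum F N} {w : WorldP} (h : IsRecordOfRecord₁₂CB10YZWB8subB12 F N D w) {cN ρ : ℝ}
    (hin : ∀ (θ : Stage12Params F N) (hP : θ.Provisos₁₂ F N), θ.Admissible F N → D = datumOfRecord₁₂ F N θ hP → w.γ ≤ θ.γ →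
      letI := θ.instVβ₁; letI := θ.instVβ₂; letI := θ.instιβ
      ScaleShiftRate cN ρ w.γ (betaMerged F (mergedTermFamilyMatT F N (TcOfRecord F N) (chiFixed7 F N θ.ν) θ.εbg) θ.ρ8 θ.bV)) :
    NE4OnData D cN ρ w.γ := by
  obtain ⟨w', hw', -, hγ, -⟩ := exists_isRecordOfRecord₁₂C_of_isRecordOfRecord₁₂CB10YZWB8subB12 h
  exact N17_of_exists_companion₁₂C ⟨w', hw', hγ⟩ hin

/-- The binder is equivalent to N17 at `IsRecordOfRecord₁₂CB10YZWB8subB12`. [cite: Balaban1987RG1, (1.20)-(1.22) p.264; Balaban1989LargeFieldII, Thm 1 p.355] -/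
theorem N17_iff_forall_of_isRecordOfRecord₁₂CB10YZWB8subB12 {D : Datum F N} {w : WorldP} (h : IsRecordOfRecord₁₂CB10YZWB8subB12 F N D w) (cN ρ : ℝ) :
    NE4OnData D cN ρ w.γ ↔
      ∀ (θ : Stage12Params F N) (hP : θ.Provisos₁₂ F N), θ.Admissible F N → D = datumOfRecord₁₂ F N θ hP → w.γ ≤ θ.γ →
        letI := θ.instVβ₁; letI := θ.instVβ₂; letI := θ.instιβ
        ScaleShiftRate cN ρ w.γ (betaMerged F (mergedTermFamilyMatT F N (TcOfRecord F N) (chiFixed7 F N θ.ν) θ.εbg) θ.ρ8 θ.bV) := by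
  obtain ⟨w', hw', -, hγ, -⟩ := exists_isRecordOfRecord₁₂C_of_isRecordOfRecord₁₂CB10YZWB8subB12 h
  exact N17_iff_forall_of_exists_companion₁₂C ⟨w', hw', hγ⟩ cN ρ

/-- **N17 AT def-B13's SEVEN-PIN RECORD `IsRecordOfRecord₁₂CB10YZWB8B12B13`** ([B13] pinned). [cite: Balaban1987RG1, (1.20)-(1.22) p.264; Balaban1989LargeFieldII, Thm 1 p.355] -/
theorem N17_of_isRecordOfRecord₁₂CB10YZWB8B12B13 {D : Datum F N} {w : WorldP} (h : IsRecordOfRecord₁₂CB10YZWB8B12B13 F N D w) {cN ρ : ℝ}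
    (hin : ∀ (θ : Stage12Params F N) (hP : θ.Provisos₁₂ F N), θ.Admissible F N → D = datumOfRecord₁₂ F N θ hP → w.γ ≤ θ.γ →
      letI := θ.instVβ₁; letI := θ.instVβ₂; letI := θ.instιβ
      ScaleShiftRate cN ρ w.γ (betaMerged F (mergedTermFamilyMatT F N (TcOfRecord F N) (chiFixed7 F N θ.ν) θ.εbg) θ.ρ8 θ.bV)) :
    NE4OnData D cN ρ w.γ := by
  obtain ⟨w', hw', -, hγ, -⟩ := exists_isRecordOfRecord₁₂C_of_isRecordOfRecord₁₂CB10YZWB8B12B13 h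
  exact N17_of_exists_companion₁₂C ⟨w', hw', hγ⟩ hin

/-- The binder is equivalent to N17 at `IsRecordOfRecord₁₂CB10YZWB8B12B13`. [cite: Balaban1987RG1, (1.20)-(1.22) p.264; Balaban1989LargeFieldII, Thm 1 p.355] -/
theorem N17_iff_forall_of_isRecordOfRecord₁₂CB10YZWB8B12B13 {D : Datum F N} {w : WorldP} (h : IsRecordOfRecord₁₂CB10YZWB8B12B13 F N D w) (cN ρ : ℝ) :
    NE4OnData D cN ρ w.γ ↔
      ∀ (θ : Stage12Params F N) (hP : θ.Provisos₁₂ F N), θ.Admissible F N → D = datumOfRecord₁₂ F N θ hP → w.γ ≤ θ.γ →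
        letI := θ.instVβ₁; letI := θ.instVβ₂; letI := θ.instιβ
        ScaleShiftRate cN ρ w.γ (betaMerged F (mergedTermFamilyMatT F N (TcOfRecord F N) (chiFixed7 F N θ.ν) θ.εbg) θ.ρ8 θ.bV) := by
  obtain ⟨w', hw', -, hγ, -⟩ := exists_isRecordOfRecord₁₂C_of_isRecordOfRecord₁₂CB10YZWB8B12B13 h
  exact N17_iff_forall_of_exists_companion₁₂C ⟨w', hw', hγ⟩ cN ρ

/-- **N17 AT def-B13's SEVEN-PIN RECORD `IsRecordOfRecord₁₂CB10YZWB8subB12B13`** ([B8′] view, [B13] pinned). [cite: Balaban1987RG1, (1.20)-(1.22) p.264; Balaban1989LargeFieldII, Thm 1 p.355] -/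
theorem N17_of_isRecordOfRecord₁₂CB10YZWB8subB12B13 {D : Datum F N} {w : WorldP} (h : IsRecordOfRecord₁₂CB10YZWB8subB12B13 F N D w) {cN ρ : ℝ}
    (hin : ∀ (θ : Stage12Params F N) (hP : θ.Provisos₁₂ F N), θ.Admissible F N → D = datumOfRecord₁₂ F N θ hP → w.γ ≤ θ.γ →
      letI := θ.instVβ₁; letI := θ.instVβ₂; letI := θ.instιβ
      ScaleShiftRate cN ρ w.γ (betaMerged F (mergedTermFamilyMatT F N (TcOfRecord F N) (chiFixed7 F N θ.ν) θ.εbg) θ.ρ8 θ.bV)) :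
    NE4OnData D cN ρ w.γ := by
  obtain ⟨w', hw', -, hγ, -⟩ := exists_isRecordOfRecord₁₂C_of_isRecordOfRecord₁₂CB10YZWB8subB12B13 h
  exact N17_of_exists_companion₁₂C ⟨w', hw', hγ⟩ hin

/-- The binder is equivalent to N17 at `IsRecordOfRecord₁₂CB10YZWB8subB12B13`. [cite: Balaban1987RG1, (1.20)-(1.22) p.264; Balaban1989LargeFieldII, Thm 1 p.355] -/
theorem N17_iff_forall_of_isRecordOfRecord₁₂CB10YZWB8subB12B13 {D : Datum F N} {w : WorldP} (h : IsRecordOfRecord₁₂CB10YZWB8subB12B13 F N D w) (cN ρ : ℝ) :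
    NE4OnData D cN ρ w.γ ↔
      ∀ (θ : Stage12Params F N) (hP : θ.Provisos₁₂ F N), θ.Admissible F N → D = datumOfRecord₁₂ F N θ hP → w.γ ≤ θ.γ →
        letI := θ.instVβ₁; letI := θ.instVβ₂; letI := θ.instιβ
        ScaleShiftRate cN ρ w.γ (betaMerged F (mergedTermFamilyMatT F N (TcOfRecord F N) (chiFixed7 F N θ.ν) θ.εbg) θ.ρ8 θ.bV) := by
  obtain ⟨w', hw', -, hγ, -⟩ := exists_isRecordOfRecord₁₂C_of_isRecordOfRecord₁₂CB10YZWB8subB12B13 h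
  exact N17_iff_forall_of_exists_companion₁₂C ⟨w', hw', hγ⟩ cN ρ

/-- **N17 AT def-B12's PROVISO-CARRYING RECORD `IsRecordOfRecord₁₂CB10YZWB8B12Prov`** (the [B12] package's provisos displayed; the ₁₂C companion does not remember them —
N17 does not read them either). [cite: Balaban1987RG1, (1.20)-(1.22) p.264; Balaban1989LargeFieldII, Thm 1 p.355] -/
theorem N17_of_isRecordOfRecord₁₂CB10YZWB8B12Prov {D : Datum F N} {w : WorldP} (h : IsRecordOfRecord₁₂CB10YZWB8B12Prov F N D w) {cN ρ : ℝ}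
    (hin : ∀ (θ : Stage12Params F N) (hP : θ.Provisos₁₂ F N), θ.Admissible F N → D = datumOfRecord₁₂ F N θ hP → w.γ ≤ θ.γ →
      letI := θ.instVβ₁; letI := θ.instVβ₂; letI := θ.instιβ
      ScaleShiftRate cN ρ w.γ (betaMerged F (mergedTermFamilyMatT F N (TcOfRecord F N) (chiFixed7 F N θ.ν) θ.εbg) θ.ρ8 θ.bV)) :
    NE4OnData D cN ρ w.γ := by
  obtain ⟨w', hw', -, hγ, -⟩ := exists_isRecordOfRecord₁₂C_of_isRecordOfRecord₁₂CB10YZWB8B12Prov h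
  exact N17_of_exists_companion₁₂C ⟨w', hw', hγ⟩ hin

/-- The binder is equivalent to N17 at `IsRecordOfRecord₁₂CB10YZWB8B12Prov`. [cite: Balaban1987RG1, (1.20)-(1.22) p.264; Balaban1989LargeFieldII, Thm 1 p.355] -/
theorem N17_iff_forall_of_isRecordOfRecord₁₂CB10YZWB8B12Prov {D : Datum F N} {w : WorldP} (h : IsRecordOfRecord₁₂CB10YZWB8B12Prov F N D w) (cN ρ : ℝ) :
    NE4OnData D cN ρ w.γ ↔
      ∀ (θ : Stage12Params F N) (hP : θ.Provisos₁₂ F N), θ.Admissible F N → D = datumOfRecord₁₂ F N θ hP → w.γ ≤ θ.γ →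
        letI := θ.instVβ₁; letI := θ.instVβ₂; letI := θ.instιβ
        ScaleShiftRate cN ρ w.γ (betaMerged F (mergedTermFamilyMatT F N (TcOfRecord F N) (chiFixed7 F N θ.ν) θ.εbg) θ.ρ8 θ.bV) := by
  obtain ⟨w', hw', -, hγ, -⟩ := exists_isRecordOfRecord₁₂C_of_isRecordOfRecord₁₂CB10YZWB8B12Prov h
  exact N17_iff_forall_of_exists_companion₁₂C ⟨w', hw', hγ⟩ cN ρ

/-- **N17 AT def-B12's PROVISO-CARRYING RECORD `IsRecordOfRecord₁₂CB10YZWB8subB12Prov`** ([B8′] view). [cite: Balaban1987RG1, (1.20)-(1.22) p.264; Balaban1989LargeFieldII, Thm 1 p.355] -/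
theorem N17_of_isRecordOfRecord₁₂CB10YZWB8subB12Prov {D : Datum F N} {w : WorldP} (h : IsRecordOfRecord₁₂CB10YZWB8subB12Prov F N D w) {cN ρ : ℝ}
    (hin : ∀ (θ : Stage12Params F N) (hP : θ.Provisos₁₂ F N), θ.Admissible F N → D = datumOfRecord₁₂ F N θ hP → w.γ ≤ θ.γ →
      letI := θ.instVβ₁; letI := θ.instVβ₂; letI := θ.instιβ
      ScaleShiftRate cN ρ w.γ (betaMerged F (mergedTermFamilyMatT F N (TcOfRecord F N) (chiFixed7 F N θ.ν) θ.εbg) θ.ρ8 θ.bV)) :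
    NE4OnData D cN ρ w.γ := by
  obtain ⟨w', hw', -, hγ, -⟩ := exists_isRecordOfRecord₁₂C_of_isRecordOfRecord₁₂CB10YZWB8subB12Prov h
  exact N17_of_exists_companion₁₂C ⟨w', hw', hγ⟩ hin

/-- The binder is equivalent to N17 at `IsRecordOfRecord₁₂CB10YZWB8subB12Prov`. [cite: Balaban1987RG1, (1.20)-(1.22) p.264; Balaban1989LargeFieldII, Thm 1 p.355] -/
theorem N17_iff_forall_of_isRecordOfRecord₁₂CB10YZWB8subB12Prov {D : Datum F N} {w : WorldP} (h : IsRecordOfRecord₁₂CB10YZWB8subB12Prov F N D w) (cN ρ : ℝ) :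
    NE4OnData D cN ρ w.γ ↔
      ∀ (θ : Stage12Params F N) (hP : θ.Provisos₁₂ F N), θ.Admissible F N → D = datumOfRecord₁₂ F N θ hP → w.γ ≤ θ.γ →
        letI := θ.instVβ₁; letI := θ.instVβ₂; letI := θ.instιβ
        ScaleShiftRate cN ρ w.γ (betaMerged F (mergedTermFamilyMatT F N (TcOfRecord F N) (chiFixed7 F N θ.ν) θ.εbg) θ.ρ8 θ.bV) := by
  obtain ⟨w', hw', -, hγ, -⟩ := exists_isRecordOfRecord₁₂C_of_isRecordOfRecord₁₂CB10YZWB8subB12Prov h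
  exact N17_iff_forall_of_exists_companion₁₂C ⟨w', hw', hγ⟩ cN ρ

end Summit.QuantumFields.YangMills.Theorems.BalabanUVNodesN17

end
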